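import Summits.HubbardSuperconductivity.HubbardSuperconductivity.Theorems.AnisotropyChordTransferFibre3ZSquareTable
import Mathlib.Analysis.Real.Pi.Bounds

/-!
# Route `AnisotropyChord` / H0 rotor rung: a KERNEL-EVALUATED exact-ℚ certificate checker for the near-pair skeleton facts (computable layer + PSD soundness)

Fourteenth file of the `TwoHoleBS` (PROP BS) chain.  The three `L`-free facts about `skelA d` needed by
`…TwoHoleBSMargin.dualCert_threeQuarter_near_of_gap` are reduced by `…TwoHoleBSCertAlgebra` to positive semidefiniteness of
matrices whose entries are AFFINE in `u = 1/π` with rational coefficients (the ℤ² window is `ℚ + ℚ/π`, `…ZSquareTable`):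
`N(u) = −A(u) + t′·11ᵀ − η·1` (10 × 10, strict conditional negative definiteness) and
`M_B(u) = [C + Cᵀ + CᵀA(u)C]_BB − (g + ½)·1 + t·11ᵀ` (8 × 8, the variational gap with a rational zero-sum charge map `C`).
PSD on `[u⁻, u⁺] ∋ 1/π` follows from PSD at the two rational endpoints (`u⁻ = 10⁶/3141593`, `u⁺ = 10⁶/3141592`,
`Real.pi_gt_d6`, `Real.pi_lt_d6`), and PSD of an explicit rational matrix is decided IN THE KERNEL by recomputing an
exact `LDLᵀ` factorisation and checking the identity `M = LDLᵀ`, `D ≥ 0` (`decide`, ≈ seconds; no data beyond `C`).  This file is the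
computable layer and its soundness:
* `iptZN`, `AgetQ` (`A(u)` on `ℕ`-indices), `sumR`, `getC`, `Bslot`, `chargeFormQ`, `MBget`, `Nget`, `tab`, `ldlRow`, `ldlRows`, `Lget`,
  `Dget`, `psdCheck`, `colSumCheck`, `uLo`, `uHi`, ★ `nearCert d C g t t′ η : Bool`;
* `sumR_eq_finset`, `getC_tab`, ★ `psdCheck_sound` (`psdCheck M n = true ⇒ Σ_{i,j<n} v_i M_ij v_j ≥ 0` over `ℝ`, Gram/`LDLᵀ`),
  `colSumCheck_sound`, `double_sum_affine`, `uLo_le_inv_pi`, `inv_pi_le_uHi`;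
* real affine forms `AaffR`, `cf0`, `cf1`, `PN`, `QN` with the cast identities `cast_AgetQ`, `cast_chargeFormQ`, `cast_MBget`, `cast_Nget`.
The link to `skelA d`, `twoHolePinf` and the three facts is `…Fibre3TwoHoleBSCertSound` (next file); per-`d` instances follow.
Prover seat `hubbard-h0-rotor-p2` g3; helper for stmt-HubbardSuperconductivity-19089 (`--supports`, helper class).
WHAT THIS IS NOT: nothing here proves superconductivity in the Hubbard model; the rotor TARGET as originally worded stays
FALSE (g15 verdict).  Verification plumbing for ONE input (HOLE₂ near-pair skeletons) of ONE conditional reduction (rung 19089).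
Mathlib + tree imports only; no sorry, no axioms.
-/

set_option linter.dupNamespace false
set_option autoImplicit false

namespace Summit.HubbardSuperconductivity.HubbardSuperconductivity.Theorems.AnisotropyChord.Transfer.Fibre3

namespace TwoHoleBS

open Subsample

/-! ## Computable layer (exact rational arithmetic, `ℕ` indices: slots `0..4` = cluster at `0`, `5..9` = cluster at `d`) -/

/-- integer coordinates of the ten slots (`ipt` on `ℕ` indices). [folklore] -/
def iptZN (d : ℤ × ℤ) : ℕ → ℤ × ℤ
  | 0 => (0, 0)
  | 1 => (1, 0)
  | 2 => (-1, 0)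
  | 3 => (0, 1)
  | 4 => (0, -1)
  | 5 => d
  | 6 => d + (1, 0)
  | 7 => d + (-1, 0)
  | 8 => d + (0, 1)
  | 9 => d + (0, -1)
  | _ => (0, 0)

/-- the kernel matrix at parameter `u` (standing for `1/π`): `A(u)_{kl} = 2(a₀(r) + u·a₁(r))`, `r = ipt k − ipt l`. [folklore] -/
def AgetQ (d : ℤ × ℤ) (u : ℚ) (k l : ℕ) : ℚ :=
  2 * ((aZ2Qz (iptZN d k - iptZN d l).1 (iptZN d k - iptZN d l).2).1
    + u * (aZ2Qz (iptZN d k - iptZN d l).1 (iptZN d k - iptZN d l).2).2)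

/-- list-based finite sum `Σ_{k<n} f k` (kernel-friendly). [folklore] -/
def sumR (n : ℕ) (f : ℕ → ℚ) : ℚ := ((List.range n).map f).sum

/-- entry of a matrix given as a list of rows (`0` off range). [folklore] -/
def getC (C : List (List ℚ)) (i j : ℕ) : ℚ := (C.getD i []).getD j 0

/-- boundary index `i < 8` ↦ slot: `0..3 ↦ 1..4`, `4..7 ↦ 6..9`. [folklore] -/
def Bslot (i : ℕ) : ℕ := if i < 4 then i + 1 else i + 2

/-- the charge quadratic form `[C + Cᵀ + CᵀA(u)C]_{pq}`. [folklore] -/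
def chargeFormQ (d : ℤ × ℤ) (C : List (List ℚ)) (u : ℚ) (p q : ℕ) : ℚ :=
  getC C p q + getC C q p + sumR 10 (fun k => sumR 10 fun l => getC C k p * AgetQ d u k l * getC C l q)

/-- `M_B(u)_{ij} = [C + Cᵀ + CᵀA(u)C]_{B_iB_j} − (g + ½)[i = j] + t`. [folklore] -/
def MBget (d : ℤ × ℤ) (C : List (List ℚ)) (g t u : ℚ) (i j : ℕ) : ℚ :=
  chargeFormQ d C u (Bslot i) (Bslot j) - (if i = j then g + 1 / 2 else 0) + t

/-- `N(u)_{kl} = −A(u)_{kl} + t − η[k = l]`. [folklore] -/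
def Nget (d : ℤ × ℤ) (t η u : ℚ) (k l : ℕ) : ℚ := -AgetQ d u k l + t - (if k = l then η else 0)

/-- tabulate an `n × n` matrix (memoisation for kernel evaluation). [folklore] -/
def tab (M : ℕ → ℕ → ℚ) (n : ℕ) : List (List ℚ) := (List.range n).map fun i => (List.range n).map fun j => M i j

/-- one row of the exact `LDLᵀ` recursion. [folklore] -/
def ldlRow (M : List (List ℚ)) (prev : List (List ℚ × ℚ)) (i : ℕ) : List ℚ × ℚ :=
  let Li := (List.range i).foldl (fun (acc : List ℚ) j =>
      let Lj := (prev.getD j ([], 0)).1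
      let Dj := (prev.getD j ([], 0)).2
      let s := (List.range j).foldl (fun s k => s + acc.getD k 0 * Lj.getD k 0 * (prev.getD k ([], 0)).2) 0
      acc ++ [if Dj = 0 then 0 else (getC M i j - s) / Dj]) []
  let Di := getC M i i - (List.range i).foldl (fun s k => s + (Li.getD k 0) ^ 2 * (prev.getD k ([], 0)).2) 0
  (Li, Di)

/-- the rows `(L_i, D_i)` of the exact `LDLᵀ` recursion. [folklore] -/
def ldlRows (M : List (List ℚ)) : ℕ → List (List ℚ × ℚ)
  | 0 => []
  | n + 1 => ldlRows M n ++ [ldlRow M (ldlRows M n) n]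

/-- unit lower-triangular factor entry. [folklore] -/
def Lget (rows : List (List ℚ × ℚ)) (i k : ℕ) : ℚ :=
  if k < i then ((rows.getD i ([], 0)).1).getD k 0 else if k = i then 1 else 0

/-- pivot. [folklore] -/
def Dget (rows : List (List ℚ × ℚ)) (k : ℕ) : ℚ := (rows.getD k ([], 0)).2

/-- ★ PSD check: recompute `L, D` and verify `M = LDLᵀ` exactly with `D ≥ 0` (no correctness proof of the recursion is needed —
only the verified identity is used). [folklore] -/
def psdCheck (M : ℕ → ℕ → ℚ) (n : ℕ) : Bool :=
  let T := tab M n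
  let rows := ldlRows T n
  ((List.range n).all fun k => decide (0 ≤ Dget rows k)) &&
  ((List.range n).all fun i => (List.range n).all fun j =>
    decide (M i j = sumR n fun k => Lget rows i k * Dget rows k * Lget rows j k))

/-- zero column sums of the charge map. [folklore] -/
def colSumCheck (C : List (List ℚ)) : Bool := (List.range 10).all fun q => decide (sumR 10 (fun p => getC C p q) = 0)

/-- `u⁻ = 10⁶/3141593 < 1/π`. [folklore] -/
def uLo : ℚ := 1000000 / 3141593

/-- `u⁺ = 10⁶/3141592 > 1/π`. [folklore] -/
def uHi : ℚ := 1000000 / 3141592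

/-- ★ the full certificate for offset `d`: zero-sum `C`, `M_B(u±) ⪰ 0`, `N(u±) ⪰ 0`, `η > 0`, `g > 0`. [folklore] -/
def nearCert (d : ℤ × ℤ) (C : List (List ℚ)) (g t t' η : ℚ) : Bool :=
  colSumCheck C && psdCheck (MBget d C g t uLo) 8 && psdCheck (MBget d C g t uHi) 8 &&
    psdCheck (Nget d t' η uLo) 10 && psdCheck (Nget d t' η uHi) 10 && decide (0 < η) && decide (0 < g)

/-! ## Soundness of the computable layer -/

open scoped BigOperators

/-- `sumR n f = Σ_{k ∈ range n} f k`. [folklore] -/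
theorem sumR_eq_finset (n : ℕ) (f : ℕ → ℚ) : sumR n f = ∑ k ∈ Finset.range n, f k := by
  induction n with
  | zero => simp [sumR]
  | succ n ih =>
    rw [Finset.sum_range_succ, ← ih]
    simp [sumR, List.range_succ]

/-- tabulation is faithful on range. [folklore] -/
theorem getC_tab (M : ℕ → ℕ → ℚ) (n i j : ℕ) (hi : i < n) (hj : j < n) : getC (tab M n) i j = M i j := by
  simp [getC, tab, List.getD_eq_getElem?_getD, List.getElem?_map, List.getElem?_range hi, List.getElem?_range hj]

/-- ★ SOUNDNESS OF THE PSD CHECK: the real quadratic form of `M` on `range n` is non-negative. [folklore] -/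
theorem psdCheck_sound (M : ℕ → ℕ → ℚ) (n : ℕ) (h : psdCheck M n = true) (v : ℕ → ℝ) :
    0 ≤ ∑ i ∈ Finset.range n, ∑ j ∈ Finset.range n, v i * (M i j : ℝ) * v j := by
  simp only [psdCheck, Bool.and_eq_true, List.all_eq_true, List.mem_range, decide_eq_true_eq] at h
  obtain ⟨hD, hM⟩ := h
  set rows := ldlRows (tab M n) n with hrows
  have hM' : ∀ i ∈ Finset.range n, ∀ j ∈ Finset.range n,
      (M i j : ℝ) = ∑ k ∈ Finset.range n, (Lget rows i k : ℝ) * (Dget rows k : ℝ) * (Lget rows j k : ℝ) := by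
    intro i hi j hj
    rw [Finset.mem_range] at hi hj
    have := hM i hi j hj
    rw [sumR_eq_finset] at this
    rw [this]
    push_cast
    rfl
  have key : ∑ i ∈ Finset.range n, ∑ j ∈ Finset.range n, v i * (M i j : ℝ) * v j
      = ∑ k ∈ Finset.range n, (Dget rows k : ℝ) * (∑ i ∈ Finset.range n, (Lget rows i k : ℝ) * v i) ^ 2 := by
    calc ∑ i ∈ Finset.range n, ∑ j ∈ Finset.range n, v i * (M i j : ℝ) * v j
        = ∑ i ∈ Finset.range n, ∑ j ∈ Finset.range n, ∑ k ∈ Finset.range n,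
            (Dget rows k : ℝ) * (((Lget rows i k : ℝ) * v i) * ((Lget rows j k : ℝ) * v j)) := by
          refine Finset.sum_congr rfl fun i hi => Finset.sum_congr rfl fun j hj => ?_
          rw [hM' i hi j hj, Finset.mul_sum, Finset.sum_mul]
          exact Finset.sum_congr rfl fun k _ => by ring
      _ = ∑ i ∈ Finset.range n, ∑ k ∈ Finset.range n, ∑ j ∈ Finset.range n,
            (Dget rows k : ℝ) * (((Lget rows i k : ℝ) * v i) * ((Lget rows j k : ℝ) * v j)) :=
          Finset.sum_congr rfl fun i _ => Finset.sum_comm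
      _ = ∑ k ∈ Finset.range n, ∑ i ∈ Finset.range n, ∑ j ∈ Finset.range n,
            (Dget rows k : ℝ) * (((Lget rows i k : ℝ) * v i) * ((Lget rows j k : ℝ) * v j)) := Finset.sum_comm
      _ = ∑ k ∈ Finset.range n, (Dget rows k : ℝ) * (∑ i ∈ Finset.range n, (Lget rows i k : ℝ) * v i) ^ 2 := by
          refine Finset.sum_congr rfl fun k _ => ?_
          rw [sq, Finset.sum_mul_sum, Finset.mul_sum]
          refine Finset.sum_congr rfl fun i _ => ?_
          rw [Finset.mul_sum]
  rw [key]
  refine Finset.sum_nonneg fun k hk => mul_nonneg ?_ (sq_nonneg _)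
  rw [Finset.mem_range] at hk
  exact_mod_cast hD k hk

/-- soundness of the column-sum check. [folklore] -/
theorem colSumCheck_sound (C : List (List ℚ)) (h : colSumCheck C = true) (q : ℕ) (hq : q < 10) :
    ∑ p ∈ Finset.range 10, (getC C p q : ℝ) = 0 := by
  simp only [colSumCheck, List.all_eq_true, List.mem_range, decide_eq_true_eq] at h
  have := h q hq
  rw [sumR_eq_finset] at this
  exact_mod_cast this

/-- a double sum of affine entries is affine. [folklore] -/
theorem double_sum_affine {ι : Type*} (s : Finset ι) (P Q : ι → ι → ℝ) (v : ι → ℝ) (u : ℝ) :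
    ∑ i ∈ s, ∑ j ∈ s, v i * (P i j + u * Q i j) * v j
      = (∑ i ∈ s, ∑ j ∈ s, v i * P i j * v j) + u * ∑ i ∈ s, ∑ j ∈ s, v i * Q i j * v j := by
  simp only [Finset.mul_sum, ← Finset.sum_add_distrib]
  exact Finset.sum_congr rfl fun i _ => Finset.sum_congr rfl fun j _ => by ring

/-- `u⁻ ≤ 1/π`. [folklore] -/
theorem uLo_le_inv_pi : ((uLo : ℚ) : ℝ) ≤ 1 / Real.pi := by
  have h := Real.pi_lt_d6
  have hpi := Real.pi_pos
  rw [uLo, Rat.cast_div, le_div_iff₀ hpi]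
  push_cast
  nlinarith

/-- `1/π ≤ u⁺`. [folklore] -/
theorem inv_pi_le_uHi : 1 / Real.pi ≤ ((uHi : ℚ) : ℝ) := by
  have h := Real.pi_gt_d6
  have hpi := Real.pi_pos
  rw [uHi, Rat.cast_div, div_le_iff₀ hpi]
  push_cast
  nlinarith

/-! ## Real affine forms and cast identities -/

/-- the real affine kernel `A(u)_{kl} = 2(a₀(r) + u·a₁(r))`. [folklore] -/
noncomputable def AaffR (d : ℤ × ℤ) (u : ℝ) (k l : ℕ) : ℝ :=
  2 * ((((aZ2Qz (iptZN d k - iptZN d l).1 (iptZN d k - iptZN d l).2).1 : ℚ) : ℝ)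
    + u * (((aZ2Qz (iptZN d k - iptZN d l).1 (iptZN d k - iptZN d l).2).2 : ℚ) : ℝ))

/-- cast of `AgetQ`. [folklore] -/
theorem cast_AgetQ (d : ℤ × ℤ) (u : ℚ) (k l : ℕ) : ((AgetQ d u k l : ℚ) : ℝ) = AaffR d u k l := by
  simp only [AgetQ, AaffR]
  push_cast
  ring

/-- constant part of the charge form. [folklore] -/
noncomputable def cf0 (d : ℤ × ℤ) (C : List (List ℚ)) (p q : ℕ) : ℝ :=
  (getC C p q : ℝ) + (getC C q p : ℝ) + ∑ k ∈ Finset.range 10, ∑ l ∈ Finset.range 10,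
    (getC C k p : ℝ) * (2 * (((aZ2Qz (iptZN d k - iptZN d l).1 (iptZN d k - iptZN d l).2).1 : ℚ) : ℝ)) * (getC C l q : ℝ)

/-- `u`-coefficient of the charge form. [folklore] -/
noncomputable def cf1 (d : ℤ × ℤ) (C : List (List ℚ)) (p q : ℕ) : ℝ :=
  ∑ k ∈ Finset.range 10, ∑ l ∈ Finset.range 10,
    (getC C k p : ℝ) * (2 * (((aZ2Qz (iptZN d k - iptZN d l).1 (iptZN d k - iptZN d l).2).2 : ℚ) : ℝ)) * (getC C l q : ℝ)

/-- the real charge form at parameter `u` is `cf0 + u·cf1`. [folklore] -/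
theorem chargeForm_affine (d : ℤ × ℤ) (C : List (List ℚ)) (u : ℝ) (p q : ℕ) :
    (getC C p q : ℝ) + (getC C q p : ℝ)
        + ∑ k ∈ Finset.range 10, ∑ l ∈ Finset.range 10, (getC C k p : ℝ) * AaffR d u k l * (getC C l q : ℝ)
      = cf0 d C p q + u * cf1 d C p q := by
  simp only [cf0, cf1, AaffR, Finset.mul_sum, add_assoc, ← Finset.sum_add_distrib]
  congr 1
  congr 1
  exact Finset.sum_congr rfl fun k _ => Finset.sum_congr rfl fun l _ => by ring

/-- cast of `chargeFormQ`. [folklore] -/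
theorem cast_chargeFormQ (d : ℤ × ℤ) (C : List (List ℚ)) (u : ℚ) (p q : ℕ) :
    ((chargeFormQ d C u p q : ℚ) : ℝ) = cf0 d C p q + (u : ℝ) * cf1 d C p q := by
  rw [← chargeForm_affine]
  simp only [chargeFormQ, sumR_eq_finset]
  push_cast
  simp only [cast_AgetQ]

/-- cast of `MBget`: `P + u·Q` with `P = cf0 − (g+½)δ + t`, `Q = cf1`. [folklore] -/
theorem cast_MBget (d : ℤ × ℤ) (C : List (List ℚ)) (g t u : ℚ) (i j : ℕ) :
    ((MBget d C g t u i j : ℚ) : ℝ)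
      = (cf0 d C (Bslot i) (Bslot j) - (if i = j then ((g : ℝ) + 1 / 2) else 0) + (t : ℝ))
        + (u : ℝ) * cf1 d C (Bslot i) (Bslot j) := by
  simp only [MBget]
  push_cast
  rw [cast_chargeFormQ]
  split_ifs <;> push_cast <;> ring

/-- constant part of `N`. [folklore] -/
noncomputable def PN (d : ℤ × ℤ) (t η : ℚ) (k l : ℕ) : ℝ :=
  -(2 * (((aZ2Qz (iptZN d k - iptZN d l).1 (iptZN d k - iptZN d l).2).1 : ℚ) : ℝ)) + (t : ℝ)
    - (if k = l then (η : ℝ) else 0)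

/-- `u`-coefficient of `N`. [folklore] -/
noncomputable def QN (d : ℤ × ℤ) (k l : ℕ) : ℝ :=
  -(2 * (((aZ2Qz (iptZN d k - iptZN d l).1 (iptZN d k - iptZN d l).2).2 : ℚ) : ℝ))

/-- `−A(u) + t − ηδ = PN + u·QN`. [folklore] -/
theorem N_affine (d : ℤ × ℤ) (t η : ℚ) (u : ℝ) (k l : ℕ) :
    -AaffR d u k l + (t : ℝ) - (if k = l then (η : ℝ) else 0) = PN d t η k l + u * QN d k l := by
  simp only [AaffR, PN, QN]
  ring

/-- cast of `Nget`. [folklore] -/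
theorem cast_Nget (d : ℤ × ℤ) (t η u : ℚ) (k l : ℕ) :
    ((Nget d t η u k l : ℚ) : ℝ) = PN d t η k l + (u : ℝ) * QN d k l := by
  rw [← N_affine, ← cast_AgetQ]
  simp only [Nget]
  split_ifs <;> push_cast <;> ring

end TwoHoleBS

end Summit.HubbardSuperconductivity.HubbardSuperconductivity.Theorems.AnisotropyChord.Transfer.Fibre3
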